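import Summits.QuantumAdvantage.QuantumAdvantage.Theorems.WalkThreeStepFarReadWitness

/-!
# Rung (G♯₂) `ThreeStepFreeRungFive` (item stmt-QuantumAdvantage-23286), architecture (U), the FAR-READ LEMMA 6/6 (part a): NO SCENE
# with an extremal far cut

Cell qa-qnc0, route OddPrimeWalk, support item stmt-QuantumAdvantage-23286; prover qn-prover-3 g17.

§1 `Scene.false_of_pair`: if the four-term sum of the far cut `hq` and of its neighbour toward `π` vanishes at every input (the output
of files 5/6, 5b/6), the scene is contradictory.  Proof: the identity reads `δ_h(x) = c_{nbr}(x)` on inputs with `10` at `π` and `h`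
(also when `hq` reads its own position); at the witness `x*` of file 5c/6, `δ_h = 1`.  If the neighbour is not a double reader, `c ≡ 0`:
contradiction.  Otherwise, if `ρ_h` is within `5` of `h`, the Y-FAMILY (`j` ones just below `π`, `5 − j` just above) keeps
`N(h), N(ρ_h), W` and moves `N(π)`: the three-point lemma refutes `dfun = cfun`; else the T-FAMILY (`j` ones just below `h`, `5 − j` just
above) keeps `N(π), N(ρ_h), W` and moves `N(h)`: `δ_h` stays `1` while `Σ_t c = 0`.
§2 `Scene.false_up` / `Scene.false_down`: with upper/lower extremality the scene is contradictory.
WHAT THIS IS NOT: the statement `FarReadHyp'` and the closing of the item are part b; separation NOT moved.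
-/

namespace Summit.QuantumAdvantage.AdviceFreeQNC0.LocalEngine

open Finset Classical

namespace RungU

variable {n : ℕ}

/-- `a•1 + c•1 = 0` forces `a = c`. -/
theorem eq_of_bt_add (a c : Bool) (h : bt a + bt c = 0) : a = c := by
  revert a c; decide

/-- casting away a multiple of five. -/
theorem cast_add_five (k : ℕ) : ((k + 5 : ℕ) : ZMod 5) = (k : ZMod 5) := by
  push_cast
  have : (5 : ZMod 5) = 0 := by decide
  rw [this, add_zero]

namespace Scene

variable (sc : Scene n)

/-! ### §1 Two-block families over a base set -/

/-- a base set with two added blocks. -/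
def fam (P : Finset ℕ) (β₁ j β₂ k : ℕ) : Finset ℕ := (P ∪ Ico β₁ (β₁ + j)) ∪ Ico β₂ (β₂ + k)

/-- membership in a two-block family. -/
theorem mem_fam {P : Finset ℕ} {β₁ j β₂ k i : ℕ} :
    i ∈ fam P β₁ j β₂ k ↔ (i ∈ P ∨ (β₁ ≤ i ∧ i < β₁ + j) ∨ (β₂ ≤ i ∧ i < β₂ + k)) := by
  unfold fam
  simp only [Finset.mem_union, Finset.mem_Ico, or_assoc]

/-- below-`r` count of a two-block family with non-straddling blocks of length `≤ 5`. -/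
theorem card_lt_fam (P : Finset ℕ) (β₁ j β₂ k r : ℕ) (hj : j ≤ 5) (hk : k ≤ 5)
    (hd₁ : ∀ i ∈ P, ¬ (β₁ ≤ i ∧ i < β₁ + 5)) (hd₂ : ∀ i ∈ P, ¬ (β₂ ≤ i ∧ i < β₂ + 5)) (h12 : β₁ + 5 ≤ β₂)
    (hr₁ : β₁ + 5 ≤ r ∨ r ≤ β₁) (hr₂ : β₂ + 5 ≤ r ∨ r ≤ β₂) :
    ((fam P β₁ j β₂ k).filter fun i => i < r).card
      = (P.filter fun i => i < r).card + (if β₁ + 5 ≤ r then j else 0) + (if β₂ + 5 ≤ r then k else 0) := by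
  unfold fam
  rw [card_lt_union_block _ β₂ k r hk (fun i hi => by
        rw [Finset.mem_union, Finset.mem_Ico] at hi
        rcases hi with hi | hi
        · have := hd₂ i hi; omega
        · omega) hr₂,
    card_lt_union_block _ β₁ j r hj (fun i hi => by have := hd₁ i hi; omega) hr₁]

/-- cardinality of a two-block family. -/
theorem card_fam (P : Finset ℕ) (β₁ j β₂ k : ℕ) (hj : j ≤ 5) (hk : k ≤ 5)
    (hd₁ : ∀ i ∈ P, ¬ (β₁ ≤ i ∧ i < β₁ + 5)) (hd₂ : ∀ i ∈ P, ¬ (β₂ ≤ i ∧ i < β₂ + 5)) (h12 : β₁ + 5 ≤ β₂) :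
    (fam P β₁ j β₂ k).card = P.card + j + k := by
  unfold fam
  rw [card_union_block _ β₂ k (fun i hi => by
        rw [Finset.mem_union, Finset.mem_Ico] at hi
        rcases hi with hi | hi
        · have := hd₂ i hi; omega
        · omega),
    card_union_block _ β₁ j (fun i hi => by have := hd₁ i hi; omega)]

/-! ### §2 No scene whose cluster is the far cut and a neighbour -/

/-- **the key identity** `δ_h(x) = c_{nbr}(x)` on inputs with `10` at `π` and `h`, from `fourTerm(hq) + fourTerm(nbr) = 0`. -/
theorem dlt_eq_c4_of_pair (qn : Fin (n + 1)) (hqn : qn.val = sc.h - 1 ∨ qn.val = sc.h + 1)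
    (hpair : ∀ x : Fin n → Bool, fourTerm sc.S sc.π sc.h x sc.hq + fourTerm sc.S sc.π sc.h x qn = 0)
    {x : Fin n → Bool} (hxh : Ten x sc.h) : dlt sc.S sc.π x sc.hq = c4 sc.S sc.π sc.h x qn := by
  have hr := sc.room
  have hh := sc.h_bounds
  have hfar := sc.far
  have hqnπ : qn.val ≠ sc.π := by omega
  have hqnh : qn.val ≠ sc.h := by omega
  have hlab : lab x qn = lab x sc.hq + 1 := by
    rcases hqn with e | e
    · exact sc.lab_pred x hxh qn e
    · exact sc.lab_succ x hxh qn e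
  have e := hpair x
  rw [fourTerm_eq_c4 _ _ _ x qn hqnπ hqnh, hlab] at e
  by_cases hself : cf sc.S sc.hq sc.h = 0
  · rw [fourTerm_self sc.S sc.πh2 (by omega) (by omega) hxh sc.hq sc.hq_val hself, ← rotZ_map_add] at e
    exact eq_of_bt_add _ _ (eq_zero_of_rotZ _ _ e)
  · rw [fourTerm_self_read sc.S (by omega) (by omega) hxh sc.hq sc.hq_val (by rw [sc.hq_val]; omega), ← rotZ_rotZ,
      ← rotZ_map_add] at e
    exact (eq_of_self_read _ _ _ (eq_zero_of_rotZ _ _ e)).1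

/-- **the Y-family** over a base set `P`: `j` ones in `[π−6, π−1)` and `5 − j` ones in `[π+1, π+6)`; modulo `5` only `N(π)` moves. -/
theorem yfam_pack (P : Finset ℕ) (hPn : ∀ i ∈ P, i < n) (h1 : sc.π - 1 ∈ P) (h0 : sc.π ∉ P) (h1' : sc.h - 1 ∈ P)
    (h0' : sc.h ∉ P) (hfree : ∀ i ∈ P, ¬ (sc.π - 6 ≤ i ∧ i < sc.π - 1) ∧ ¬ (sc.π + 1 ≤ i ∧ i < sc.π + 6))
    (hρ : sc.ρh + 6 ≤ sc.π ∨ sc.π + 6 ≤ sc.ρh) (j : ℕ) (hj : j < 5) :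
    ∃ Q : Finset ℕ, (∀ i ∈ Q, i < n) ∧ sc.π - 1 ∈ Q ∧ sc.π ∉ Q ∧ sc.h - 1 ∈ Q ∧ sc.h ∉ Q ∧
      (((Q.filter fun i => i < sc.π).card : ℕ) : ZMod 5) = (((P.filter fun i => i < sc.π).card : ℕ) : ZMod 5) + (j : ℕ) ∧
      (((Q.filter fun i => i < sc.ρh).card : ℕ) : ZMod 5) = (((P.filter fun i => i < sc.ρh).card : ℕ) : ZMod 5) ∧
      (((Q.filter fun i => i < sc.h).card : ℕ) : ZMod 5) = (((P.filter fun i => i < sc.h).card : ℕ) : ZMod 5) ∧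
      ((Q.card : ℕ) : ZMod 5) = ((P.card : ℕ) : ZMod 5) := by
  have hr := sc.room
  have hh := sc.h_bounds
  have hfar := sc.far
  have hd₁ : ∀ i ∈ P, ¬ (sc.π - 6 ≤ i ∧ i < sc.π - 6 + 5) := fun i hi h' => (hfree i hi).1 ⟨h'.1, by omega⟩
  have hd₂ : ∀ i ∈ P, ¬ (sc.π + 1 ≤ i ∧ i < sc.π + 1 + 5) := fun i hi h' => (hfree i hi).2 ⟨h'.1, by omega⟩
  refine ⟨fam P (sc.π - 6) j (sc.π + 1) (5 - j), fun i hi => ?_, mem_fam.mpr (Or.inl h1), fun hm => ?_,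
    mem_fam.mpr (Or.inl h1'), fun hm => ?_, ?_, ?_, ?_, ?_⟩
  · rw [mem_fam] at hi; rcases hi with hi | hi | hi
    · exact hPn i hi
    · omega
    · omega
  · rw [mem_fam] at hm; rcases hm with hm | hm | hm
    · exact h0 hm
    · omega
    · omega
  · rw [mem_fam] at hm; rcases hm with hm | hm | hm
    · exact h0' hm
    · omega
    · omega
  · rw [card_lt_fam P _ j _ (5 - j) sc.π (by omega) (by omega) hd₁ hd₂ (by omega) (Or.inl (by omega)) (Or.inr (by omega)),
      if_pos (show sc.π - 6 + 5 ≤ sc.π by omega), if_neg (show ¬ (sc.π + 1 + 5 ≤ sc.π) by omega), add_zero, Nat.cast_add]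
  · rw [card_lt_fam P _ j _ (5 - j) sc.ρh (by omega) (by omega) hd₁ hd₂ (by omega) (by omega) (by omega)]
    rcases hρ with c | c
    · rw [if_neg (show ¬ (sc.π - 6 + 5 ≤ sc.ρh) by omega), if_neg (show ¬ (sc.π + 1 + 5 ≤ sc.ρh) by omega), add_zero, add_zero]
    · rw [if_pos (show sc.π - 6 + 5 ≤ sc.ρh by omega), if_pos (show sc.π + 1 + 5 ≤ sc.ρh by omega),
        show (P.filter fun i => i < sc.ρh).card + j + (5 - j) = (P.filter fun i => i < sc.ρh).card + 5 by omega, cast_add_five]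
  · rw [card_lt_fam P _ j _ (5 - j) sc.h (by omega) (by omega) hd₁ hd₂ (by omega) (by omega) (by omega)]
    rcases hfar with c | c
    · rw [if_pos (show sc.π - 6 + 5 ≤ sc.h by omega), if_pos (show sc.π + 1 + 5 ≤ sc.h by omega),
        show (P.filter fun i => i < sc.h).card + j + (5 - j) = (P.filter fun i => i < sc.h).card + 5 by omega, cast_add_five]
    · rw [if_neg (show ¬ (sc.π - 6 + 5 ≤ sc.h) by omega), if_neg (show ¬ (sc.π + 1 + 5 ≤ sc.h) by omega), add_zero, add_zero]
  · rw [card_fam P _ j _ (5 - j) (by omega) (by omega) hd₁ hd₂ (by omega),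
      show P.card + j + (5 - j) = P.card + 5 by omega, cast_add_five]

/-- **the T-family** over a base set `P`: `j` ones in `[h−6, h−1)` and `5 − j` ones in `[h+1, h+6)`; modulo `5` only `N(h)` moves
(when `ρ_h` is at distance `≥ 6` from `h`). -/
theorem tfam_pack (P : Finset ℕ) (hPn : ∀ i ∈ P, i < n) (h1 : sc.π - 1 ∈ P) (h0 : sc.π ∉ P) (h1' : sc.h - 1 ∈ P)
    (h0' : sc.h ∉ P) (hfree : ∀ i ∈ P, ¬ (sc.h - 6 ≤ i ∧ i < sc.h - 1) ∧ ¬ (sc.h + 1 ≤ i ∧ i < sc.h + 6))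
    (hρ : sc.ρh + 6 ≤ sc.h ∨ sc.h + 6 ≤ sc.ρh) (j : ℕ) (hj : j < 5) :
    ∃ Q : Finset ℕ, (∀ i ∈ Q, i < n) ∧ sc.π - 1 ∈ Q ∧ sc.π ∉ Q ∧ sc.h - 1 ∈ Q ∧ sc.h ∉ Q ∧
      (((Q.filter fun i => i < sc.π).card : ℕ) : ZMod 5) = (((P.filter fun i => i < sc.π).card : ℕ) : ZMod 5) ∧
      (((Q.filter fun i => i < sc.ρh).card : ℕ) : ZMod 5) = (((P.filter fun i => i < sc.ρh).card : ℕ) : ZMod 5) ∧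
      (((Q.filter fun i => i < sc.h).card : ℕ) : ZMod 5) = (((P.filter fun i => i < sc.h).card : ℕ) : ZMod 5) + (j : ℕ) ∧
      ((Q.card : ℕ) : ZMod 5) = ((P.card : ℕ) : ZMod 5) := by
  have hr := sc.room
  have hh := sc.h_bounds
  have hfar := sc.far
  have hd₁ : ∀ i ∈ P, ¬ (sc.h - 6 ≤ i ∧ i < sc.h - 6 + 5) := fun i hi h' => (hfree i hi).1 ⟨h'.1, by omega⟩
  have hd₂ : ∀ i ∈ P, ¬ (sc.h + 1 ≤ i ∧ i < sc.h + 1 + 5) := fun i hi h' => (hfree i hi).2 ⟨h'.1, by omega⟩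
  refine ⟨fam P (sc.h - 6) j (sc.h + 1) (5 - j), fun i hi => ?_, mem_fam.mpr (Or.inl h1), fun hm => ?_,
    mem_fam.mpr (Or.inl h1'), fun hm => ?_, ?_, ?_, ?_, ?_⟩
  · rw [mem_fam] at hi; rcases hi with hi | hi | hi
    · exact hPn i hi
    · omega
    · omega
  · rw [mem_fam] at hm; rcases hm with hm | hm | hm
    · exact h0 hm
    · omega
    · omega
  · rw [mem_fam] at hm; rcases hm with hm | hm | hm
    · exact h0' hm
    · omega
    · omega
  · rw [card_lt_fam P _ j _ (5 - j) sc.π (by omega) (by omega) hd₁ hd₂ (by omega) (by omega) (by omega)]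
    rcases hfar with c | c
    · rw [if_neg (show ¬ (sc.h - 6 + 5 ≤ sc.π) by omega), if_neg (show ¬ (sc.h + 1 + 5 ≤ sc.π) by omega), add_zero, add_zero]
    · rw [if_pos (show sc.h - 6 + 5 ≤ sc.π by omega), if_pos (show sc.h + 1 + 5 ≤ sc.π by omega),
        show (P.filter fun i => i < sc.π).card + j + (5 - j) = (P.filter fun i => i < sc.π).card + 5 by omega, cast_add_five]
  · rw [card_lt_fam P _ j _ (5 - j) sc.ρh (by omega) (by omega) hd₁ hd₂ (by omega) (by omega) (by omega)]
    rcases hρ with c | c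
    · rw [if_neg (show ¬ (sc.h - 6 + 5 ≤ sc.ρh) by omega), if_neg (show ¬ (sc.h + 1 + 5 ≤ sc.ρh) by omega), add_zero, add_zero]
    · rw [if_pos (show sc.h - 6 + 5 ≤ sc.ρh by omega), if_pos (show sc.h + 1 + 5 ≤ sc.ρh by omega),
        show (P.filter fun i => i < sc.ρh).card + j + (5 - j) = (P.filter fun i => i < sc.ρh).card + 5 by omega, cast_add_five]
  · rw [card_lt_fam P _ j _ (5 - j) sc.h (by omega) (by omega) hd₁ hd₂ (by omega) (Or.inl (by omega)) (Or.inr (by omega)),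
      if_pos (show sc.h - 6 + 5 ≤ sc.h by omega), if_neg (show ¬ (sc.h + 1 + 5 ≤ sc.h) by omega), add_zero, Nat.cast_add]
  · rw [card_fam P _ j _ (5 - j) (by omega) (by omega) hd₁ hd₂ (by omega),
      show P.card + j + (5 - j) = P.card + 5 by omega, cast_add_five]

/-- **NO SCENE whose cluster is `{hq, nbr}`**: `fourTerm(hq) + fourTerm(nbr) = 0` at every input is contradictory. -/
theorem false_of_pair (qn : Fin (n + 1)) (hqn : qn.val = sc.h - 1 ∨ qn.val = sc.h + 1)
    (hpair : ∀ x : Fin n → Bool, fourTerm sc.S sc.π sc.h x sc.hq + fourTerm sc.S sc.π sc.h x qn = 0) : False := by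
  have hr := sc.room
  have hh := sc.h_bounds
  have hfar := sc.far
  have hqnπ : qn.val ≠ sc.π := by omega
  have hqnh : qn.val ≠ sc.h := by omega
  obtain ⟨P, hPn, h1, h0, h1', h0', hδ, hfreeT, hfreeY⟩ := sc.exists_witness
  by_cases hmem : qn ∈ pairSet sc.S sc.π sc.h
  swap
  · -- the neighbour is not a double reader: c ≡ 0, but δ(x*) = 1
    have th : Ten (indic P : Fin n → Bool) sc.h := ten_indic P (by omega) h1' h0'
    have e1 := sc.dlt_eq_c4_of_pair qn hqn hpair th
    have e2 : fourTerm sc.S sc.π sc.h (indic P : Fin n → Bool) qn = 0 := fourTerm_eq_zero_of_not_mem sc.S sc.πh2 _ qn hmem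
    rw [fourTerm_eq_c4 _ _ _ _ qn hqnπ hqnh] at e2
    have e3 := (bt_eq_zero _).mp (eq_zero_of_rotZ _ _ e2)
    rw [hδ, e3] at e1
    exact Bool.noConfusion e1
  · obtain ⟨ca', cb'⟩ := sc.cf_ne_zero_of_mem hmem hqnπ hqnh
    -- generic evaluation of δ and c at an indicator input
    have evalδ : ∀ Q : Finset ℕ, (∀ i ∈ Q, i < n) → sc.π - 1 ∈ Q → sc.π ∉ Q →
        dlt sc.S sc.π (indic Q : Fin n → Bool) sc.hq = dfun (cf sc.S sc.hq sc.π) (otherCoef sc.S sc.hq sc.π) (sc.S.γ sc.hq)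
          (sc.S.r sc.hq) (((Q.filter fun i => i < sc.π).card : ℕ) : ZMod 5) (((Q.filter fun i => i < sc.ρh).card : ℕ) : ZMod 5)
          ((Q.card : ℕ) : ZMod 5) := by
      intro Q hQ q1 q0
      rw [dlt_eq_dfun sc.S sc.hq sc.reads (by omega) (by omega) (ten_indic Q (by omega) q1 q0), wtPrefix_indic Q hQ,
        wtPrefix_indic Q hQ, wt_indic Q hQ]
      rfl
    have evalc : ∀ Q : Finset ℕ, (∀ i ∈ Q, i < n) → sc.π - 1 ∈ Q → sc.π ∉ Q → sc.h - 1 ∈ Q → sc.h ∉ Q →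
        c4 sc.S sc.π sc.h (indic Q : Fin n → Bool) qn = cfun (cf sc.S qn sc.π) (cf sc.S qn sc.h) (sc.S.γ qn) (sc.S.r qn)
          (((Q.filter fun i => i < sc.π).card : ℕ) : ZMod 5) (((Q.filter fun i => i < sc.h).card : ℕ) : ZMod 5)
          ((Q.card : ℕ) : ZMod 5) := by
      intro Q hQ q1 q0 q1' q0'
      rw [c4_eq_cfun sc.S qn sc.πh2 ca' cb' (by omega) (by omega) (by omega) (by omega) (ten_indic Q (by omega) q1 q0)
        (ten_indic Q (by omega) q1' q0'), wtPrefix_indic Q hQ, wtPrefix_indic Q hQ, wt_indic Q hQ]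
    have keyQ : ∀ Q : Finset ℕ, (∀ i ∈ Q, i < n) → sc.π - 1 ∈ Q → sc.π ∉ Q → sc.h - 1 ∈ Q → sc.h ∉ Q →
        dfun (cf sc.S sc.hq sc.π) (otherCoef sc.S sc.hq sc.π) (sc.S.γ sc.hq) (sc.S.r sc.hq)
          (((Q.filter fun i => i < sc.π).card : ℕ) : ZMod 5) (((Q.filter fun i => i < sc.ρh).card : ℕ) : ZMod 5)
          ((Q.card : ℕ) : ZMod 5)
        = cfun (cf sc.S qn sc.π) (cf sc.S qn sc.h) (sc.S.γ qn) (sc.S.r qn)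
          (((Q.filter fun i => i < sc.π).card : ℕ) : ZMod 5) (((Q.filter fun i => i < sc.h).card : ℕ) : ZMod 5)
          ((Q.card : ℕ) : ZMod 5) := by
      intro Q hQ q1 q0 q1' q0'
      rw [← evalδ Q hQ q1 q0, ← evalc Q hQ q1 q0 q1' q0']
      exact sc.dlt_eq_c4_of_pair qn hqn hpair (ten_indic Q (by omega) q1' q0')
    have hδ' := hδ
    rw [evalδ P hPn h1 h0] at hδ'
    by_cases hnear : sc.h ≤ sc.ρh + 5 ∧ sc.ρh ≤ sc.h + 5
    · -- Y-FAMILY: N(π) moves, the rest is fixed: three-point contradiction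
      apply yfam_false (cf sc.S sc.hq sc.π) (otherCoef sc.S sc.hq sc.π) (sc.S.γ sc.hq) (sc.S.r sc.hq)
        (((P.filter fun i => i < sc.ρh).card : ℕ) : ZMod 5) ((P.card : ℕ) : ZMod 5)
        (cf sc.S qn sc.π) (cf sc.S qn sc.h) (sc.S.γ qn) (sc.S.r qn)
        (((P.filter fun i => i < sc.h).card : ℕ) : ZMod 5) ((P.card : ℕ) : ZMod 5)
        (((P.filter fun i => i < sc.π).card : ℕ) : ZMod 5) sc.reads ca' cb'
      intro j hj
      obtain ⟨Q, hQn, q1, q0, q1', q0', c1, c2, c3, c4⟩ := sc.yfam_pack P hPn h1 h0 h1' h0' (hfreeY hnear) (by omega) j hj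
      have e := keyQ Q hQn q1 q0 q1' q0'
      rw [c1, c2, c3, c4] at e
      exact e
    · -- T-FAMILY: N(h) moves, the rest is fixed: δ stays 1 while Σ_t c = 0
      have hfive := tfam_zero (cf sc.S qn sc.π) (cf sc.S qn sc.h) (sc.S.γ qn) (sc.S.r qn)
        (((P.filter fun i => i < sc.π).card : ℕ) : ZMod 5) ((P.card : ℕ) : ZMod 5)
        (((P.filter fun i => i < sc.h).card : ℕ) : ZMod 5) true (fun j hj => by
          obtain ⟨Q, hQn, q1, q0, q1', q0', c1, c2, c3, c4⟩ := sc.tfam_pack P hPn h1 h0 h1' h0' hfreeT (by omega) j hj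
          have e := keyQ Q hQn q1 q0 q1' q0'
          rw [c1, c2, c3, c4, hδ'] at e
          exact e)
      exact Bool.noConfusion hfive

/-! ### §3 No extremal scene -/

/-- **no scene with an upper-extremal far cut.** -/
theorem false_up (hup : sc.π + 128 ≤ sc.h) (hmax : sc.UpMax) : False :=
  sc.false_of_pair sc.qdn (Or.inl sc.qdn_val) (sc.up_pair_eq_zero hup hmax)

/-- **no scene with a lower-extremal far cut.** -/
theorem false_down (hdown : sc.h + 128 ≤ sc.π) (hmin : sc.DownMin) : False :=
  sc.false_of_pair sc.qup (Or.inr sc.qup_val) (sc.down_pair_eq_zero hdown hmin)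

end Scene

end RungU

end Summit.QuantumAdvantage.AdviceFreeQNC0.LocalEngine
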